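import Literature.AlgebraicGeometry.Frobenioids.PerfFactorialPerfection
import Literature.AlgebraicGeometry.Frobenioids.PerfectionPrimes
import HarnessLib

/-!
# Frobenioids I, Def. 2.4 (i)(c)(d): the support `Supp(a)` of the factorization, read on primary elements

Mochizuki, *The geometry of Frobenioids I*, Kyushu J. Math. **62** (2008), §0 p. 12 (primary elements, primes,
`Bound_S(b)`, suprema) and Definition 2.4 (i)(c)(d), kurims p. 47: the factorization homomorphism
`M^pf → ∏_{𝔭} M_𝔭 ⊗ ℝ_{≥0}`, `a ↦ (sup Bound_{𝔭 ∪ {0}}(a))_𝔭`, and "`Supp(a)`", the set of primes at which the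
component of `a` is nonzero [cite: MochizukiFrdI2008, Def. 2.4(i) p.47] [cite: MochizukiFrdI2008, §0 p.12].

PROOF-ONLY.  For a perf-factorial monoid `M` (tree: `IsPerfFactorial`, `factorMap`, `supp`, seat abc-iut-L1-t14)
the support of the factorization is computed WITHOUT the factorization:
* `IsPerfFactorial.mem_supp_factorMap_iff` — for `a ∈ M^pf` and `𝔮 ∈ Prime(M^pf)`:
  `𝔮 ∈ Supp(a)` iff some primary element `x` of the class `𝔮` satisfies `x ≤ a` (the supremum defining the
  `𝔮`-component is over `Bound_{𝔮 ∪ {0}}(a)`, which is `{0}` exactly when no such `x` exists);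
* `IsPerfFactorial.mem_supp_factorMap_of_iff` — for `a ∈ M` and `𝔭 ∈ Prime(M) ≅ Prime(M^pf)`
  (`Primes.perfectionEquiv`): the prime of `M^pf` corresponding to `𝔭` lies in `Supp(a)` iff some primary
  `a₀ ∈ 𝔭` satisfies `a₀ ≼ a` (i.e. `a₀ ≤ n · a` for some `n ≥ 1`) — the form in which the support predicate
  of Def. 2.4 (i)(d) enters Def. 4.5 (ii)/(iii) (rational / rationally standard type) in the §6 examples
  (requested by abc-iut-L6-t10, S3 sub-DAG row T64i/L10, INBOX 2026-08-26T00:39:16Z (3)).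
Seat abc-iut-L1-d2 (cell abc-iut).
-/

noncomputable section

namespace Literature.AlgebraicGeometry.Frobenioids

open Function

universe u

namespace IsPerfFactorial

variable {M : Type u} [CommMonoid M] (h : IsPerfFactorial M)
include h

/-- **`𝔮 ∈ Supp(a)` iff some primary `x ∈ 𝔮` divides `a`** (`a ∈ M^pf`, `M` perf-factorial): the
`𝔮`-component `sup Bound_{𝔮 ∪ {0}}(a)` of the factorization of `a` is nonzero exactly when
`Bound_{𝔮 ∪ {0}}(a) ≠ {0}`. [cite: MochizukiFrdI2008, Def. 2.4(i) p.47] -/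
theorem mem_supp_factorMap_iff (a : Perfection M) (𝔮 : Primes (Perfection M)) :
    𝔮 ∈ supp (factorMap M a) ↔ ∃ x ∈ 𝔮.carrier, x ∣ a := by
  constructor
  · intro hne
    by_contra hno
    apply hne
    -- no primary element of `𝔮` divides `a`: `Bound_{𝔮 ∪ {0}}(a) = {0}`, bounded by `0`
    have hb : IsBoundedBy (boundAt M 𝔮 a) 1 := by
      rintro _ ⟨x, hx, hxa, rfl⟩
      rcases hx with hx | hx
      · exact (hno ⟨x.1, hx, hxa⟩).elim
      · have : x = 1 := Subtype.ext hx
        rw [this, map_one]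
    exact (isSharp_realification _).1 _ (isUnit_of_dvd_one ((h.factorMap_spec 1).mp hb))
  · rintro ⟨x, hx, hxa⟩ h1
    have hxmem : x ∈ 𝔮.submonoid := Submonoid.subset_closure hx
    have hdvd := h.of_dvd_factorMap ⟨x, hxmem⟩ (Or.inl hx) hxa
    rw [h1] at hdvd
    have hunit := (isSharp_realification _).1 _ (isUnit_of_dvd_one hdvd)
    have hinj := Realification.of_injective
      (isMonoprime_submonoid_primes_perfection h.isDivisorial.isSharp h.isMonoprime 𝔮)
    have : (⟨x, hxmem⟩ : PfAt M 𝔮) = 1 := hinj (by rw [hunit, map_one])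
    exact hx.1.1 (congrArg Subtype.val this)

/-- **The support of (the factorization of) `a ∈ M`, read in `M`**: for `𝔭 ∈ Prime(M)` and the corresponding
prime `𝔮` of `M^pf` (`Prime(M) ≅ Prime(M^pf)`, §0 p. 12), `𝔮 ∈ Supp(a)` iff some primary `a₀ ∈ 𝔭` satisfies
`a₀ ≼ a`, i.e. `a₀ ≤ n · a` for some `n ≥ 1`. [cite: MochizukiFrdI2008, Def. 2.4(i) p.47] -/
theorem mem_supp_factorMap_of_iff (a : M) (𝔭 : Primes M) :
    Primes.perfectionEquiv h.isDivisorial.isSharp 𝔭 ∈ supp (factorMap M (Perfection.of M a)) ↔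
      ∃ a₀ ∈ 𝔭.carrier, a₀ ≼ a := by
  have hM : IsSharp M := h.isDivisorial.isSharp
  rw [h.mem_supp_factorMap_iff]
  constructor
  · rintro ⟨y, hy, z, hz⟩
    obtain ⟨⟨a₀, n⟩, rfl⟩ := Perfection.mk_surjective y
    obtain ⟨⟨c, m⟩, rfl⟩ := Perfection.mk_surjective z
    dsimp only at hy hz
    have ha₀ : a₀ ∈ 𝔭.carrier := (Primes.mk_mem_carrier_perfectionEquiv_iff hM 𝔭 a₀ n).mp hy
    refine ⟨a₀, ha₀, (n : ℕ) * (m : ℕ), Nat.mul_pos n.pos m.pos, a₀ ^ ((m : ℕ) - 1) * c ^ (n : ℕ), ?_⟩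
    -- `of a = a₀^{1/n} c^{1/m} = (a₀^m c^n)^{1/(nm)}`, so `a^{nm} = a₀^m c^n` in `M`
    have h1 : Perfection.of M (a ^ ((n : ℕ) * (m : ℕ))) = Perfection.of M (a₀ ^ (m : ℕ) * c ^ (n : ℕ)) := by
      rw [map_pow, hz, Perfection.mk_mul_mk, ← PNat.mul_coe, Perfection.mk_pow_self]
    have h2 : a ^ ((n : ℕ) * (m : ℕ)) = a₀ ^ (m : ℕ) * c ^ (n : ℕ) :=
      of_injective_of_isSharp_isIntegral_isSaturated hM h.isDivisorial.isPreDivisorial.isIntegral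
        h.isDivisorial.isPreDivisorial.isSaturated h1
    rw [h2, ← mul_assoc, ← pow_succ', Nat.sub_add_cancel (Nat.succ_le_of_lt m.pos)]
  · rintro ⟨a₀, ha₀, n, hn, c, hc⟩
    set N : ℕ+ := ⟨n, hn⟩ with hN
    refine ⟨Perfection.mk a₀ N, (Primes.mk_mem_carrier_perfectionEquiv_iff hM 𝔭 a₀ N).mpr ha₀,
      Perfection.mk c N, ?_⟩
    -- `of a = (a^n)^{1/n} = (a₀ c)^{1/n} = a₀^{1/n} c^{1/n}`
    have hc' : a ^ (N : ℕ) = a₀ * c := hc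
    rw [Perfection.mk_mul_mk_same, ← hc', Perfection.of_apply, ← Perfection.mk_pow_mul a 1 N, one_mul]

/-- The same with the class written out: `𝔮(𝔭) ∈ Supp(a)` iff `∃ a₀` primary with `[a₀] = 𝔭` and `a₀ ≼ a`
(the axiom shape of the support predicate used by abc-iut-L6-t10's rational-type theorems).
[cite: MochizukiFrdI2008, Def. 2.4(i) p.47] -/
theorem mem_supp_factorMap_of_iff' (a : M) (𝔭 : Primes M) :
    Primes.perfectionEquiv h.isDivisorial.isSharp 𝔭 ∈ supp (factorMap M (Perfection.of M a)) ↔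
      ∃ (a₀ : M) (h₀ : IsPrimary a₀), Quotient.mk (primarySetoid M) ⟨a₀, h₀⟩ = 𝔭 ∧ a₀ ≼ a := by
  rw [h.mem_supp_factorMap_of_iff]
  constructor
  · rintro ⟨a₀, ⟨h₀, h𝔭⟩, ha⟩
    exact ⟨a₀, h₀, h𝔭, ha⟩
  · rintro ⟨a₀, h₀, h𝔭, ha⟩
    exact ⟨a₀, ⟨h₀, h𝔭⟩, ha⟩

end IsPerfFactorial

end Literature.AlgebraicGeometry.Frobenioids
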